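import Mathlib.Data.Nat.Pairing
import Literature.MeasureTheory.Lusin.LusinTheorem

/-!
# Compact exhaustions on which a measurable map is continuous (Lusin + inner regularity, countably many times)

Topic `Literature/MeasureTheory/Lusin`.  Fully proved (no definitions, no named facts).  For a finite Borel measure `μ` on a Hausdorff
space which is weakly regular and inner regular by compact sets (automatic on Polish spaces), a measurable map `f : X → Y` into a
second-countable space, and measurable sets `Λ ℓ`, `ℓ ∈ ℕ`, carrying `μ`-almost every point:

* `measure_eq_zero_of_forall_le_inv` — `μ S = 0` as soon as `μ S ≤ (k+1)⁻¹` for all `k`;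
* `exists_isCompact_exhaustion_continuousOn` — countably many COMPACT sets `P i ⊆ Λ (ℓ i)`, still carrying `μ`-almost every point
  (`μ (⋃ i, P i)ᶜ = 0`), on each of which `f` is continuous.

This is the measure-theoretic skeleton of "compact Pesin sets with continuous Lyapunov charts" (Barreira–Pesin 2023 §4.3: regular sets
`Λ_ℓ` exhaust a.e., charts are Borel; Lusin makes them continuous on compact parts) in the exact shape consumed by
`Literature.Dynamics.Hyperbolic.HasAmbientClosing` (`∃ P : ℕ → Set E, (∀ ℓ, IsCompact (P ℓ)) ∧ … ∧ m (⋃ ℓ, P ℓ)ᶜ = 0 ∧ …`).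

## References

* A. S. Kechris, *Classical Descriptive Set Theory*, GTM 156, Springer (1995), Thm 17.12 (Lusin). [Kechris1995]
* L. Barreira, Ya. Pesin, *Introduction to Smooth Ergodic Theory*, 2nd ed., GSM 231, AMS (2023), §4.3. [BarreiraPesin2023]
-/

noncomputable section

open Set Filter TopologicalSpace
open _root_.MeasureTheory
open scoped ENNReal Topology

namespace Literature.MeasureTheory.Lusin

/-- A set of measure `≤ (k+1)⁻¹` for every `k` is null. [folklore] -/
theorem measure_eq_zero_of_forall_le_inv {X : Type*} [MeasurableSpace X] {μ : Measure X} {S : Set X}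
    (h : ∀ k : ℕ, μ S ≤ ((k : ℝ≥0∞) + 1)⁻¹) : μ S = 0 := by
  by_contra hne
  obtain ⟨n, hn⟩ := ENNReal.exists_inv_nat_lt hne
  have h1 : ((n : ℝ≥0∞) + 1)⁻¹ ≤ (n : ℝ≥0∞)⁻¹ := ENNReal.inv_le_inv.2 le_self_add
  exact absurd ((h n).trans h1) (not_le.2 hn)

variable {X Y : Type*} [TopologicalSpace X] [MeasurableSpace X] [OpensMeasurableSpace X]
  [TopologicalSpace Y] [SecondCountableTopology Y] [MeasurableSpace Y] [OpensMeasurableSpace Y]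
  {μ : Measure X} {f : X → Y}

/-- **Compact exhaustion with continuity.**  Let `μ` be a finite, weakly regular Borel measure, inner regular by compact sets, on a
Hausdorff space `X`; `f : X → Y` measurable into a second-countable space; `Λ ℓ` (`ℓ ∈ ℕ`) measurable with `μ (⋃ ℓ, Λ ℓ)ᶜ = 0`.  Then
there are compact sets `P i` (`i ∈ ℕ`), each inside some `Λ (ℓ i)`, with `μ (⋃ i, P i)ᶜ = 0` and `f` continuous on every `P i`.
[folklore] -/
theorem exists_isCompact_exhaustion_continuousOn [T2Space X] [IsFiniteMeasure μ] [μ.WeaklyRegular] [μ.InnerRegularCompactLTTop]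
    (hf : Measurable f) {Λ : ℕ → Set X} (hΛ : ∀ ℓ, MeasurableSet (Λ ℓ)) (hfull : μ (⋃ ℓ, Λ ℓ)ᶜ = 0) :
    ∃ (P : ℕ → Set X) (ℓ : ℕ → ℕ), (∀ i, IsCompact (P i)) ∧ (∀ i, P i ⊆ Λ (ℓ i)) ∧ μ (⋃ i, P i)ᶜ = 0 ∧
      ∀ i, ContinuousOn f (P i) := by
  -- compact `K ℓ k ⊆ Λ ℓ` with defect `< (k+1)⁻¹` and `f` continuous on it
  have hK : ∀ ℓ k : ℕ, ∃ K : Set X, K ⊆ Λ ℓ ∧ IsCompact K ∧ μ (Λ ℓ \ K) < ((k : ℝ≥0∞) + 1)⁻¹ ∧ ContinuousOn f K :=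
    fun ℓ k => exists_isCompact_subset_diff_lt_continuousOn hf (hΛ ℓ) (by simp)
  choose K hKΛ hKc hKμ hKf using hK
  refine ⟨fun i => K (Nat.unpair i).1 (Nat.unpair i).2, fun i => (Nat.unpair i).1, fun i => hKc _ _, fun i => hKΛ _ _, ?_,
    fun i => hKf _ _⟩
  -- `⋃ i, K (unpair i) = ⋃ ℓ k, K ℓ k` carries almost every point
  have hU : (⋃ i, K (Nat.unpair i).1 (Nat.unpair i).2) = ⋃ ℓ, ⋃ k, K ℓ k := iSup_unpair K
  have hnull : ∀ ℓ, μ (Λ ℓ \ ⋃ k, K ℓ k) = 0 := fun ℓ =>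
    measure_eq_zero_of_forall_le_inv fun k => (measure_mono (sdiff_subset_sdiff_right (subset_iUnion _ k))).trans (hKμ ℓ k).le
  rw [hU]
  refine le_antisymm ?_ bot_le
  have hsub : (⋃ ℓ, ⋃ k, K ℓ k)ᶜ ⊆ (⋃ ℓ, Λ ℓ)ᶜ ∪ ⋃ ℓ, (Λ ℓ \ ⋃ k, K ℓ k) := by
    intro x hx
    by_cases hxΛ : x ∈ ⋃ ℓ, Λ ℓ
    · obtain ⟨ℓ, hℓ⟩ := mem_iUnion.1 hxΛ
      refine Or.inr (mem_iUnion.2 ⟨ℓ, hℓ, fun hxK => hx ?_⟩)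
      exact mem_iUnion.2 ⟨ℓ, hxK⟩
    · exact Or.inl hxΛ
  calc μ (⋃ ℓ, ⋃ k, K ℓ k)ᶜ ≤ μ ((⋃ ℓ, Λ ℓ)ᶜ ∪ ⋃ ℓ, (Λ ℓ \ ⋃ k, K ℓ k)) := measure_mono hsub
    _ ≤ μ (⋃ ℓ, Λ ℓ)ᶜ + μ (⋃ ℓ, (Λ ℓ \ ⋃ k, K ℓ k)) := measure_union_le _ _
    _ ≤ 0 + ∑' ℓ, μ (Λ ℓ \ ⋃ k, K ℓ k) := add_le_add hfull.le (measure_iUnion_le _)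
    _ = 0 := by simp [hnull]

end Literature.MeasureTheory.Lusin

end
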